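import Summits.ValiantsHypothesis.ValiantsHypothesis.Theorems.KPlusLogSqLawTropicalGradedWalkDefs

/-!
# Route «KPlusLogSqLaw» — GRW-lite (all-`m` `K = 4` family): the chain over the phases `1 ≤ w ≤ m − 1` WITH the `u = 1` pair, definitions

HONEST FRAMING.  Definitions-only file (D-0009) of the helper chain `--supports` the crux
`Summit.ValiantsHypothesis.ValiantsHypothesis.Theses.KPlusLogSqLaw.TropicalB` (item `stmt-ValiantsHypothesis-19771`, route `KPlusLogSqLaw`;
cell `pub-symmetroid`, seat val-sym-trop-p3 g15, 2026-08-29), on top of `…TropicalGradedWalkDefs.lean`.  Bookkeeping functions only;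
nothing is proved here and nothing bears on `TropicalB`, `WeakLifting`, `MatrixDescartes` or `VP ≠ VNP`.

CONTENT.  The chain of ALL states of the phases `1 ≤ w ≤ m − 1` of the design of `…TropicalGradedWalkDefs` in slope order (the `u = 1`
excursion pair included, now that `isDominant_X1` is typed): per phase `D(w,0,0), D(w,1,0), X(w,1,1), …, D(w,w−1,0), X(w,w−1,1),
T(w,w,0), …, T(w,w,w)`, `3w` states.  `nxt2` = successor, `seqR2 k` = `k`-th state from `D(1,0,0)`, `ValidR2` = invariant, `posR2` / `offP2` /
`idxR2` = position / offset / rank.  The companion file `…GradedWalkChainTwo.lean` proves the count `offP2 (n+1) = 3n(n+1)/2`.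
-/

set_option linter.dupNamespace false
set_option autoImplicit false

namespace Summit.ValiantsHypothesis.ValiantsHypothesis.Theorems.LacunarySymmetroidMatrixDescartes.TropicalCensus

namespace GradedWalk

/-- successor of a state `(w, u, t)` in the full chain of the phases `w < m`. -/
def nxt2 (s : ℕ × ℕ × ℕ) : ℕ × ℕ × ℕ :=
  if s.2.1 < s.1 then
    (if s.2.2 = 0 then
      (if s.2.1 = 0 then (if 1 < s.1 then (s.1, 1, 0) else (s.1, s.1, 0)) else (s.1, s.2.1, 1))
     else (if s.2.1 + 1 < s.1 then (s.1, s.2.1 + 1, 0) else (s.1, s.1, 0)))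
  else (if s.2.2 < s.1 then (s.1, s.1, s.2.2 + 1) else (s.1 + 1, 0, 0))

/-- the `k`-th state of the full chain (starting at `D(1,0,0)`). -/
def seqR2 (k : ℕ) : ℕ × ℕ × ℕ := nxt2^[k] (1, 0, 0)

/-- the states of the full chain: `D(w,u,0)` with `u < w`; `X(w,u,1)` with `1 ≤ u < w`; `T(w,w,t)` with `t ≤ w`; `w ≥ 1`. -/
def ValidR2 (s : ℕ × ℕ × ℕ) : Prop :=
  1 ≤ s.1 ∧ ((s.2.1 < s.1 ∧ s.2.2 = 0) ∨ (1 ≤ s.2.1 ∧ s.2.1 < s.1 ∧ s.2.2 = 1) ∨ (s.2.1 = s.1 ∧ s.2.2 ≤ s.1))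

/-- number of states in the phases `1, …, w − 1`: `offP2 w = 3·(1 + ⋯ + (w−1))`. -/
def offP2 : ℕ → ℕ
  | 0 => 0
  | w + 1 => offP2 w + 3 * w

/-- position of a state inside its phase. -/
def posR2 (s : ℕ × ℕ × ℕ) : ℕ :=
  if s.2.1 < s.1 then (if s.2.2 = 0 then (if s.2.1 = 0 then 0 else 2 * s.2.1 - 1) else 2 * s.2.1)
  else 2 * s.1 - 1 + s.2.2

/-- rank of a state in the full chain. -/
def idxR2 (s : ℕ × ℕ × ℕ) : ℕ := offP2 s.1 + posR2 s

end GradedWalk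

end Summit.ValiantsHypothesis.ValiantsHypothesis.Theorems.LacunarySymmetroidMatrixDescartes.TropicalCensus
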